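import Summits.Schanuel.Schanuel.Theorems.RootDecomp1BMovingZeroFree03

/-!
# RootDecomp1BMovingZeroFree — lens 4, generation 42 «LEVEL-e SLOT BY PROOF» (RULE E-R21 (c) + B-R26 (a″); VERDICT L2187: THEOREM ×1 (B-g42)): the (1 | ρ) moving-zero storey HYPOTHESIS-FREE and one exponential order lower — `∀ ρ, LiouvilleOrder 7 ρ → 4 ≤ polarDeg (1, ρ)` and every (1|ρ) cell / member / 1K-link instance of FactDischarge01 + MovingZero02 §4 UNCONDITIONAL (record: order 8 mod hX) — the slot `ExpOneAlgApprox C` (an approximation measure for e with the degree binder n ≤ Y) filled BY PROOF from the Literature theorem NW96 Thm 4 (2), new separating member T₈ = towerNumber 8 — continuation (RootDecomp1BMovingZeroFree04): §4 members + T₈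

(lens-4 g42 HOME kernel MovingZeroFree.lean 1a475554…, 622 l, imports tree RootDecomp1BFactDischarge01 + Literature ExpOneTranscendenceMeasureProofs; CLAIM L2168, ACK/RULING/CHECKLIST B-g42 L2169, NODE L2183 / REQUEST L2184 / RESULT L2185, writer re-check L2186, critic VERDICT L2187 (CLEARED — THEOREM ×1 (B-g42); RULE B-R28; PORT GO 01–05 along K's § boundaries, `--supports stmt-Schanuel-24622`); port by census-1 gen 18 as `RootDecomp1BMovingZeroFree01`–`05`: 01 = §1 the slot `ExpOneAlgApprox` + its two suppliers (record hX, and BY PROOF from NW96 Thm 4(2)); 02 = §2 the budget and the engine one order lower (slot + `LiouvilleOrder 7` + moving zero ⟹ t ≥ 4); 03 = §3 the cells HYPOTHESIS-FREE; 04 = §4 members binder-free + the separating member `T₈ = towerNumber 8`; 05 = §5 the record recovered as an instance.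
PORT EDITS: the slot def's docstring tagged «[slot] definition with parameter; suppliers …» per the verdict (census convention); no `set_option` in K; three tree-twin helpers made `private` after the dedup bounce of 01 (p830609: `irreducible_map_rat_of_irreducible` ≡ Literature NW1996, `nesterenkoWaldschmidt1996_thm_4_2_inScope` ≡ `NesterenkoWaldschmidt1996_thm_4_2_holds`, `one_lt_log_sixteen` ≡ Literature Waldschmidt1978) with per-part private copies; likewise `log_le_log_add_div_sub_one` (≡ Literature Fourier SlitStrip, bounce p830636) and `one_le_log_add_one`; and `four_le_polarDeg_one_ultra` (§3 read-back ≡ tree `RootDecomp1BFactDischarge.four_le_polarDeg_one_ultra`, bounce p830998); statements and proofs verbatim. `--supports stmt-Schanuel-24622`; no census credit carried; rung 0 — nothing here proves Schanuel.)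
-/

noncomputable section

open Complex Polynomial

namespace Summit.Schanuel.Schanuel.Theorems.RootDecomp1BMovingZeroFree

open Summit.Schanuel.Schanuel.Theorems.RootDecomp1KHyper (LWMeasure)
open Summit.Schanuel.Schanuel.Theorems.RootDecomp1KHyper.HyperCell (log_sixteen_lt_three HyperLiouville lambdaH
  hyperLiouville_lambdaH ExplicitRatExpApprox C₀rat)
open Summit.Schanuel.Schanuel.Theorems.RootDecomp1KGeneric (LiouvilleOrder)
open Summit.Schanuel.Schanuel.Theorems.RootDecomp1KFiniteOrderCell (towerNumber liouvilleOrder_towerNumber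
  not_hyperLiouville_towerNumber towerNumber_sub_rat_lower liouville_towerNumber not_liouvilleOrder_towerNumber)
open Summit.Schanuel.Schanuel.Theorems.RootDecomp1BFedFlagCore (polarDeg polarField)
open Summit.Schanuel.Schanuel.Theorems.RootDecomp1BDefectFloorDefs (SharpRelativeLindemannAt TameDefectZeroAt
  WildSharpDefectZeroAt WildSharpDefectZeroInitAt)
open Summit.Schanuel.Schanuel.Theorems.RootDecomp1BRadicalDescent (UltraLiouville linearIndependent_one_of_irrational)
open Summit.Schanuel.Schanuel.Theorems.RootDecomp1BMovingZero (triple MovingZeroApprox algebraicIndependent_triple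
  isAlgebraic_pair_of_lt_four mem_polarField_one mem_polarField_swap factor_le four_le_polarDeg_of_movingZero
  liouvilleOrder_rhoT not_hyperLiouville_rhoT not_ultraLiouville_rhoT)
open Summit.Schanuel.Schanuel.Theorems.RootDecomp1BFactDischarge (lwMeasure_holds movingZeroApprox_holds)
open Literature.NumberTheory.Transcendental (NesterenkoWaldschmidt1996_thm_4_2 NesterenkoWaldschmidt1996_thm_4_2_holds)
open Literature.NumberTheory.Transcendental.NW1996 (approx_measure_exp_one)

/-! ## §4  Members — binder-free — and the new separating member `T₈ = towerNumber 8` -/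

section Members

/-- **The `1 − log 2` margin (named).**  For `c ≥ 2` and `q ≥ 7`: `2q · 2^{q^c} ≤ e^{q^c}` — since
`e^{q^c} = e^{(1 − log 2) q^c} · 2^{q^c}` and `e^{(1 − log 2) q^c} ≥ 1 + (1 − log 2) q^c ≥ 1 + 0.3 · 7q > 2q`
(`q^c ≥ q² ≥ 7q`, `1 − log 2 > 0.3`, `e^x ≥ 1 + x`). -/
theorem two_mul_two_pow_le_exp_pow {c q : ℕ} (hc : 2 ≤ c) (hq : 7 ≤ q) :
    2 * (q : ℝ) * (2 : ℝ) ^ (q ^ c) ≤ Real.exp ((q : ℝ) ^ c) := by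
  have hq7 : (7 : ℝ) ≤ q := by exact_mod_cast hq
  obtain ⟨x, hx⟩ : ∃ x : ℝ, x = (q : ℝ) ^ c := ⟨_, rfl⟩
  have hx0 : 0 ≤ x := by rw [hx]; positivity
  have hpow2 : (2 : ℝ) ^ (q ^ c) = Real.exp (x * Real.log 2) := by
    rw [← Real.rpow_natCast, Real.rpow_def_of_pos (by norm_num : (0 : ℝ) < 2), hx]
    congr 1
    push_cast
    ring
  have hxq : 7 * (q : ℝ) ≤ x := by
    have h2 : (q : ℝ) ^ 2 ≤ (q : ℝ) ^ c := pow_le_pow_right₀ (by linarith) hc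
    have h3 : 7 * (q : ℝ) ≤ (q : ℝ) ^ 2 := by nlinarith
    rw [hx]; linarith
  have hl2 := Real.log_two_lt_d9
  rw [← hx, hpow2]
  have hsplit : Real.exp x = Real.exp (x * (1 - Real.log 2)) * Real.exp (x * Real.log 2) := by
    rw [← Real.exp_add]; ring_nf
  rw [hsplit]
  refine mul_le_mul_of_nonneg_right ?_ (Real.exp_pos _).le
  have h1 : x * (1 - Real.log 2) + 1 ≤ Real.exp (x * (1 - Real.log 2)) := Real.add_one_le_exp _
  have h2 : (0.3 : ℝ) ≤ 1 - Real.log 2 := by linarith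
  have h3 : 7 * (q : ℝ) * 0.3 ≤ x * (1 - Real.log 2) := mul_le_mul hxq h2 (by norm_num) hx0
  linarith

/-- **`T_c` does NOT have exponential order `c`** (`c ≥ 2`) — sharpening the tree's
`not_liouvilleOrder_towerNumber : ¬ LiouvilleOrder (c+1) (towerNumber c)` by one: the tree's effective
irrationality measure `|T_c − p/q| ≥ 1/(2q·2^{q^c})` (`towerNumber_sub_rat_lower`) beats `exp(−q^c)` at the
order-`c` approximant with `q ≥ 7`, by the margin lemma `two_mul_two_pow_le_exp_pow`. -/
theorem not_liouvilleOrder_self_towerNumber {c : ℕ} (hc : 2 ≤ c) : ¬ LiouvilleOrder c (towerNumber c) := by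
  intro h
  obtain ⟨r, hden, -, hlt⟩ := h 7
  have hq7 : (7 : ℝ) ≤ r.den := by exact_mod_cast hden
  have hq0 : (0 : ℝ) < r.den := by linarith
  have hlow := towerNumber_sub_rat_lower hc r (le_trans (by norm_num) hden)
  have hkey := two_mul_two_pow_le_exp_pow hc hden
  -- `exp(−q^c) ≤ 1/(2q · 2^{q^c})`
  have hexp : Real.exp (-((r.den : ℝ) ^ c)) ≤ 1 / (2 * (r.den : ℝ) * (2 : ℝ) ^ (r.den ^ c)) := by
    rw [Real.exp_neg, ← one_div]
    exact one_div_le_one_div_of_le (by positivity) hkey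
  linarith

/-- **THE NEW SEPARATING MEMBER `T₈ = towerNumber 8`:** exponential order `7` (tree `liouvilleOrder_towerNumber 7`)
but NOT of order `8` — so OUTSIDE the class of record (order 8) — and not hyper-, not ultra-Liouville. -/
theorem towerNumber_eight_position :
    LiouvilleOrder 7 (towerNumber 8) ∧ ¬ LiouvilleOrder 8 (towerNumber 8) ∧
      ¬ HyperLiouville (towerNumber 8) ∧ ¬ UltraLiouville (towerNumber 8) :=
  ⟨liouvilleOrder_towerNumber 7, not_liouvilleOrder_self_towerNumber (by norm_num),
    not_hyperLiouville_towerNumber (by norm_num),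
    fun h => not_hyperLiouville_towerNumber (by norm_num) h.hyperLiouville⟩

/-- `(1, T₈)` is `ℚ`-free. -/
theorem linearIndependent_one_towerNumber_eight : LinearIndependent ℚ ![(1 : ℝ), towerNumber 8] :=
  linearIndependent_one_of_irrational ((liouvilleOrder_towerNumber 7).liouville (by norm_num)).irrational

/-- **X(2) AT `(1, T₈)`** — UNCONDITIONAL; a storey-two cell at a ratio of order 7 and NOT 8 (no earlier cell,
conditional or not, reaches it). -/
theorem four_le_polarDeg_one_towerNumber_eight : ((2 + 2 : ℕ) : Cardinal) ≤ polarDeg ![(1 : ℝ), towerNumber 8] :=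
  four_le_polarDeg_one_of_liouvilleOrder_seven (liouvilleOrder_towerNumber 7)

/-- The At-steps of items 32406–08 AT `(1, T₈)` — UNCONDITIONAL. -/
theorem atSteps_one_towerNumber_eight :
    SharpRelativeLindemannAt 1 ![(1 : ℝ), towerNumber 8] ∧ TameDefectZeroAt 1 ![(1 : ℝ), towerNumber 8] ∧
      WildSharpDefectZeroAt 1 ![(1 : ℝ), towerNumber 8] ∧ WildSharpDefectZeroInitAt 1 ![(1 : ℝ), towerNumber 8] :=
  ⟨sharpRelativeLindemannAt_one (liouvilleOrder_towerNumber 7), tameDefectZeroAt_one (liouvilleOrder_towerNumber 7),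
    wildSharpDefectZeroAt_one (liouvilleOrder_towerNumber 7), wildSharpDefectZeroInitAt_one (liouvilleOrder_towerNumber 7)⟩

/-- **X(2) AT `(1, ρ_T)`**, `ρ_T = towerNumber 9` (the record's named non-hyper member) — now UNCONDITIONAL
(tree `RootDecomp1BFactDischarge.four_le_polarDeg_one_rhoT (hX)`, `hX`-FREE). -/
theorem four_le_polarDeg_one_rhoT : ((2 + 2 : ℕ) : Cardinal) ≤ polarDeg ![(1 : ℝ), towerNumber 9] :=
  four_le_polarDeg_one_of_liouvilleOrder_eight liouvilleOrder_rhoT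

/-- **X(2) AT `(1, λ_H)`** — the hyper-Liouville member of 1K — UNCONDITIONAL. -/
theorem four_le_polarDeg_one_lambdaH : ((2 + 2 : ℕ) : Cardinal) ≤ polarDeg ![(1 : ℝ), lambdaH] :=
  four_le_polarDeg_one_hyper hyperLiouville_lambdaH

/-- The 1K live link (item 33364) AT the member `T₈`, all three binders discharged or unused — UNCONDITIONAL. -/
theorem finiteOrderLiouvilleSchanuel_instance_towerNumber_eight :
    ((2 + 2 : ℕ) : Cardinal) ≤ Algebra.trdeg ℚ ↥(IntermediateField.adjoin ℚ
        (Set.range (Fin.append (fun j => ((![(1 : ℝ), towerNumber 8] j : ℝ) : ℂ))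
            (fun j => ((![(1 : ℝ), towerNumber 8] j : ℝ) : ℂ) * Complex.I)) ∪
          Set.range (Complex.exp ∘ Fin.append (fun j => ((![(1 : ℝ), towerNumber 8] j : ℝ) : ℂ))
            (fun j => ((![(1 : ℝ), towerNumber 8] j : ℝ) : ℂ) * Complex.I)))) :=
  four_le_polarDeg_one_towerNumber_eight

end Members

end Summit.Schanuel.Schanuel.Theorems.RootDecomp1BMovingZeroFree

end
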